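import Summits.Langlands.Langlands.Theses.QuadraticWindow

/-!
# Birth skeleton (BC3) of the D5 piece `RegularSatakeBeyondWindow` of the split of `BeyondTheWindow` (stmt-Langlands-3202)

≥ 2 NAMED stubs `stub_*` (sorry) and the kernel-checked composition `RegularSatakeBeyondWindow_of : stubs → RegularSatakeBeyondWindow`
concluding the piece's statement VERBATIM (the piece is not yet a route decl: it is written out).  To be
published as `Lines/birth.lean` of the child item once the split of `BeyondTheWindow` lands.
-/

set_option linter.dupNamespace false
set_option linter.unusedVariables false

noncomputable section

namespace Summit.Langlands.Langlands.Cruxes.BeyondTheWindow.Birth.RegularSatakeBeyondWindow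

open scoped Classical
open Summit.Langlands.Langlands.Theses.QuadraticWindow
open Literature.NumberTheory.Automorphic Literature.NumberTheory.GaloisRepresentations
open NumberField IsDedekindDomain Filter Polynomial

/-- **stub 1 — the totally real / CM case = lang.S27 BY NAME** (Harris–Lan–Taylor–Thorne 2016 Thm. A,
Scholze 2015 Thm. 1.0.4: every `ℓ`, every `v ∤ ℓ` where `π_v` is unramified; an unproved named fact of the
tree, `xl` formalisation debt, not mathematics). [cite: HarrisLanTaylorThorneRMS2016, Thm. A] -/
theorem stub_cmOrTotallyReal : Literature.NumberTheory.Automorphic.exists_galoisRep_of_regularAlgebraic := by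
  sorry

/-- **stub 2 — the mixed-signature case off the window**: `F` neither totally real nor CM, `π` regular
algebraic cuspidal, `(F, π, ℓ)` carrying no quadratic-window data: a semisimple `ρ` with cofinite
Satake–Frobenius matching in the HLTT normalisation.  OPEN (no construction of `ρ_π` is known for any such
`π`, `n ≥ 3`: Calegari 2021, §12 fn 57); the declared open content of the piece. [cite: Calegari2023, §12] -/
theorem stub_mixedSignature : ∀ (F : Type) [Field F] [NumberField F], ¬ (NumberField.IsTotallyReal F ∨ NumberField.IsCMField F) → ∀ (n : ℕ), 0 < n → ∀ (hcpt : Literature.NumberTheory.Automorphic.isCompact_glFiniteIntegralLevel n F) (π : Literature.NumberTheory.Automorphic.CuspidalAutomorphicRepData n F hcpt), π.1.IsRegularAlgebraic → ∀ (ℓ : ℕ) [Fact ℓ.Prime] (ι : PadicAlgCl ℓ ≃+* ℂ), ¬ (∃ (F₀ : Type) (_ : Field F₀) (_ : NumberField F₀) (_ : Algebra F₀ F) (τ : F ≃ₐ[F₀] F) (e : Literature.NumberTheory.GaloisRepresentations.FramedGaloisRep F₀ ℂ 1) (k : ℤ), NumberField.IsTotallyReal F₀ ∧ Module.finrank F₀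 F = 2 ∧ τ ≠ 1 ∧ (∀ᶠ w in Filter.cofinite, ∀ (α β : Multiset ℂ) (c : ℂ), π.1.HasSatakeParamAt w α → π.1.HasSatakeParamAt (τ • w) β → e.HasFrobCharpolyAt (w.under (NumberField.RingOfIntegers F₀)) (Polynomial.X - Polynomial.C c) → β = α.map (fun a ↦ a⁻¹ * (c * ((w.under (NumberField.RingOfIntegers F₀)).residueCard : ℂ) ^ k) ^ w.asIdeal.inertiaDeg (NumberField.RingOfIntegers F₀))) ∧ ((e.restrictField F).IsOdd ∨ ∀ (φ : F →+* ℝ) (c : Field.absoluteGaloisGroup F), Literature.NumberTheory.GaloisRepresentations.IsComplexConjugation φ c → Matrix.GeneralLinearGroup.det ((e.restrictField F) c) = 1) ∧ (Odd n → (e.restrictField F).IsOdd) ∧ (∃ᶠ w in Filter.cofinite, ∃ α β : Multiset ℂ, π.1.HasSatakeParamAt w α ∧ π.1.HasSatakeParamAt (τ • w) β ∧ β ≠ α) ∧ ¬ ((ℓ : ℤ) ∣ NumberField.discr F) ∧ (∀ w : IsDedekindDomain.HeightOneSpectrum (NumberField.RingOfIntegers F), ((ℓ : ℕ) : NumberField.RingOfIntegers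 F) ∈ w.asIdeal → π.1.IsUnramifiedAt w)) → ∃ ρ : Literature.NumberTheory.GaloisRepresentations.FramedGaloisRep F (PadicAlgCl ℓ) n, ρ.toGaloisRep.IsSemisimple ∧ ∀ᶠ w in Filter.cofinite, ∀ α : Multiset ℂ, π.1.HasSatakeParamAt w α → ρ.IsUnramifiedAt w ∧ ρ.HasFrobCharpolyAt w (Literature.NumberTheory.Automorphic.arithFrobPolyOfSatake ι w.residueCard n α) := by
  sorry

/-- **Composition (real proof):** lang.S27 on totally real / CM fields (all places `v ∤ ℓ` ⇒ all but the
finitely many places above `ℓ`) and stub 2 elsewhere give the piece verbatim. [folklore] -/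
theorem RegularSatakeBeyondWindow_of
    (h₁ : Literature.NumberTheory.Automorphic.exists_galoisRep_of_regularAlgebraic)
    (h₂ : ∀ (F : Type) [Field F] [NumberField F], ¬ (NumberField.IsTotallyReal F ∨ NumberField.IsCMField F) → ∀ (n : ℕ), 0 < n → ∀ (hcpt : Literature.NumberTheory.Automorphic.isCompact_glFiniteIntegralLevel n F) (π : Literature.NumberTheory.Automorphic.CuspidalAutomorphicRepData n F hcpt), π.1.IsRegularAlgebraic → ∀ (ℓ : ℕ) [Fact ℓ.Prime] (ι : PadicAlgCl ℓ ≃+* ℂ), ¬ (∃ (F₀ : Type) (_ : Field F₀) (_ : NumberField F₀) (_ : Algebra F₀ F) (τ : F ≃ₐ[F₀] F) (e : Literature.NumberTheory.GaloisRepresentations.FramedGaloisRep F₀ ℂ 1) (k : ℤ), NumberField.IsTotallyReal F₀ ∧ Module.finrank F₀ F = 2 ∧ τ ≠ 1 ∧ (∀ᶠ w in Filter.cofinite, ∀ (α β : Multiset ℂ) (c : ℂ), π.1.HasSatakeParamAt w α → π.1.HasSatakeParamAt (τ • w) β → e.HasFrobCharpolyAt (w.under (NumberField.RingOfIntegers F₀))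 (Polynomial.X - Polynomial.C c) → β = α.map (fun a ↦ a⁻¹ * (c * ((w.under (NumberField.RingOfIntegers F₀)).residueCard : ℂ) ^ k) ^ w.asIdeal.inertiaDeg (NumberField.RingOfIntegers F₀))) ∧ ((e.restrictField F).IsOdd ∨ ∀ (φ : F →+* ℝ) (c : Field.absoluteGaloisGroup F), Literature.NumberTheory.GaloisRepresentations.IsComplexConjugation φ c → Matrix.GeneralLinearGroup.det ((e.restrictField F) c) = 1) ∧ (Odd n → (e.restrictField F).IsOdd) ∧ (∃ᶠ w in Filter.cofinite, ∃ α β : Multiset ℂ, π.1.HasSatakeParamAt w α ∧ π.1.HasSatakeParamAt (τ • w) β ∧ β ≠ α) ∧ ¬ ((ℓ : ℤ) ∣ NumberField.discr F) ∧ (∀ w : IsDedekindDomain.HeightOneSpectrum (NumberField.RingOfIntegers F), ((ℓ : ℕ) : NumberField.RingOfIntegers F) ∈ w.asIdeal → π.1.IsUnramifiedAt w)) → ∃ ρ : Literature.NumberTheory.GaloisRepresentations.FramedGaloisRep F (PadicAlgCl ℓ) n, ρ.toGaloisRep.IsSemisimple ∧ ∀ᶠ w in Filter.cofinite, ∀ α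 : Multiset ℂ, π.1.HasSatakeParamAt w α → ρ.IsUnramifiedAt w ∧ ρ.HasFrobCharpolyAt w (Literature.NumberTheory.Automorphic.arithFrobPolyOfSatake ι w.residueCard n α)) :
    ∀ (F : Type) [Field F] [NumberField F] (n : ℕ), 0 < n → ∀ (hcpt : Literature.NumberTheory.Automorphic.isCompact_glFiniteIntegralLevel n F) (π : Literature.NumberTheory.Automorphic.CuspidalAutomorphicRepData n F hcpt), π.1.IsRegularAlgebraic → ∀ (ℓ : ℕ) [Fact ℓ.Prime] (ι : PadicAlgCl ℓ ≃+* ℂ), ¬ (∃ (F₀ : Type) (_ : Field F₀) (_ : NumberField F₀) (_ : Algebra F₀ F) (τ : F ≃ₐ[F₀] F) (e : Literature.NumberTheory.GaloisRepresentations.FramedGaloisRep F₀ ℂ 1) (k : ℤ), NumberField.IsTotallyReal F₀ ∧ Module.finrank F₀ F = 2 ∧ τ ≠ 1 ∧ (∀ᶠ w in Filter.cofinite, ∀ (α β : Multiset ℂ) (c : ℂ), π.1.HasSatakeParamAt w α → π.1.HasSatakeParamAt (τ • w) β → e.HasFrobCharpolyAt (w.under (NumberField.RingOfIntegers F₀))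 (Polynomial.X - Polynomial.C c) → β = α.map (fun a ↦ a⁻¹ * (c * ((w.under (NumberField.RingOfIntegers F₀)).residueCard : ℂ) ^ k) ^ w.asIdeal.inertiaDeg (NumberField.RingOfIntegers F₀))) ∧ ((e.restrictField F).IsOdd ∨ ∀ (φ : F →+* ℝ) (c : Field.absoluteGaloisGroup F), Literature.NumberTheory.GaloisRepresentations.IsComplexConjugation φ c → Matrix.GeneralLinearGroup.det ((e.restrictField F) c) = 1) ∧ (Odd n → (e.restrictField F).IsOdd) ∧ (∃ᶠ w in Filter.cofinite, ∃ α β : Multiset ℂ, π.1.HasSatakeParamAt w α ∧ π.1.HasSatakeParamAt (τ • w) β ∧ β ≠ α) ∧ ¬ ((ℓ : ℤ) ∣ NumberField.discr F) ∧ (∀ w : IsDedekindDomain.HeightOneSpectrum (NumberField.RingOfIntegers F), ((ℓ : ℕ) : NumberField.RingOfIntegers F) ∈ w.asIdeal → π.1.IsUnramifiedAt w)) → ∃ ρ : Literature.NumberTheory.GaloisRepresentations.FramedGaloisRep F (PadicAlgCl ℓ) n, ρ.toGaloisRep.IsSemisimple ∧ ∀ᶠ w in Filter.cofinite, ∀ α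 : Multiset ℂ, π.1.HasSatakeParamAt w α → ρ.IsUnramifiedAt w ∧ ρ.HasFrobCharpolyAt w (Literature.NumberTheory.Automorphic.arithFrobPolyOfSatake ι w.residueCard n α) := by
  intro F _ _ n hn hcpt π hreg ℓ _ ι hw
  by_cases hF : IsTotallyReal F ∨ IsCMField F
  · obtain ⟨r, hss, hr⟩ := h₁ hcpt hF π hreg ℓ ι
    refine ⟨r, hss, ?_⟩
    have hfin : ∀ᶠ w : HeightOneSpectrum (𝓞 F) in cofinite, ((ℓ : ℕ) : 𝓞 F) ∉ w.asIdeal := by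
      have hne : (Ideal.span {((ℓ : ℕ) : 𝓞 F)} : Ideal (𝓞 F)) ≠ ⊥ := by
        rw [Ne, Ideal.span_singleton_eq_bot]
        exact_mod_cast (Fact.out : ℓ.Prime).ne_zero
      rw [Filter.eventually_cofinite]
      refine (Ideal.finite_factors hne).subset fun w hw => ?_
      exact Ideal.dvd_span_singleton.mpr (not_not.mp hw)
    filter_upwards [hfin] with w hw α hα
    exact hr w α hα hw
  · exact h₂ F hF n hn hcpt π hreg ℓ ι hw

end Summit.Langlands.Langlands.Cruxes.BeyondTheWindow.Birth.RegularSatakeBeyondWindow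

end
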